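import Literature.AnabelianGeometry.EtaleTheta.Discharge.Sec2Prop26ProfiniteTrueAtMonodromyModelA
import HarnessLib

/-!
# [EtTh] Prop. 2.6, PROFINITE clause, HOLDS at the monodromy model — part B: the case `Ċ̲` (`Π_{Ċ̲} = A ∪ A·ηι ≅ ℤ/l × D̂_∞`) (proof-only)

S. Mochizuki, *The étale theta function and its Frobenioid-theoretic manifestations* [EtTh], Publ. RIMS **45** (2009), §2
Prop. 2.6, PRIMS p. 266 = PDF p. 40: «any isomorphism of topological groups `Π^tp_{Ẋ̲̲_α} ⥲ Π^tp_{Ẋ̲̲_β}` (respectively, `Ẋ̲`; `Ċ̲̲`;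
`Ċ̲`) induces isomorphisms compatible with the various natural maps between the respective "`Π^tp`'s" of `X̲̲` (respectively, `X̲`;
`C̲̲`; `C̲`) and `Ċ`. A similar statement holds when "`Π^tp`" is replaced by "`Π`".» [cite: MochizukiEtTh2009, Prop 2.6 p.40];
Rmk. 2.6.1 p. 40 (`Aut_K(Ẋ̲̲) = μ_l × {±1}`, …) [cite: MochizukiEtTh2009, Rmk 2.6.1 p.40].
Cell abc-iut, block F (FACT-proving wave), seat abc-iut-f-142 (gen 13), FACT-LIST row **F-0611**
`ThetaCovers.TemperedCoverData.Prop26_profinite` (the last sentence of Prop. 2.6 as typed by abc-iut-L2-t2; class «universal-closure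
REFUTED / schema», abc-iut-f-143; instance form returned OPEN-SIZED by abc-iut-f-108 g4) — INSTANCE at abc-iut-w6-d084's monodromy model
`monodromyModel l hl` (tempered twin PROVED there: `prop26_monodromyModel`).

WHAT IS PROVED: `zc_eq_z_pow`, `toAdd_mul_eq_one_of_zc_aut` (an automorphism acting on `η⟨z⟩` by `z ↦ z^k` has `k` a unit),
`rot_of_aut_closure_dotCu` (automorphisms of `B = cl(η Π^tp_{Ċ̲})` map `η t` into `R`: `γ(ηt) ∈ A` since `A·ηι` has exponent `2l` while
`R` is torsion-free, and the relation `ι t ι⁻¹ = t⁻¹` kills the `η⟨z⟩`-component — no shears in `ℤ/l × D̂_∞`, `l` odd),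
`apply_zc_of_scaling`, `conj_rot_mul_iotaM`, and **`exists_hatExtension_dotCu`**: every topological automorphism of `B` extends to `Π_C`
stabilising the closures of `Π^tp_{Ċ̲}`, `Π^tp_{C̲}`, `Π^tp_Ċ` — `γ = Σ ∘ conj(w) ∘ (scaleAut k ∘ halfShift(−ε))^∧` on `B`.
Sequel: `Sec2Prop26ProfiniteTrueAtMonodromyModel.lean` (case `Ẋ̲`; `(monodromyModel l hl).Prop26_profinite`).

HONEST LABEL (abc-iut-L2-lead R1352, inherited from the carrier): «a DESIGNED tempered toy with print's monodromy combinatorics —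
loop ↦ `Δ̄^ell` (`b`-cycle), the inversion INVERTS it, unipotent monodromy `x ↦ x·z` on the `a`-cycle, `z` = cusp inertia = `Δ̄_Θ`
central; `G_K := 1`; NOT a Tate curve, NOT the tempered fundamental group of a curve; consistency ≠ faithfulness.» PROOF-ONLY
companion (0 `def`, 0 `instance`, 0 notation, 0 `Prop`-definition; nothing of abc-iut-w6-d084's model files or of abc-iut-L2-t2's
interface is edited or restated). Instance-at-OUR-carrier ≠ [EtTh] Prop. 2.6 for the profinite fundamental groups of a curve;
typed ≠ proved; no side is taken on [IUTchIII] Cor. 3.12 or on any author; nothing here asserts abc proved or refuted.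
-/

noncomputable section

namespace Literature.AnabelianGeometry.EtaleTheta.ThetaCovers.MonodromyModel

open Multiplicative HeisenbergWitness TemperedModel DihedralGroup Topology
open Literature.AnabelianGeometry.SemiGraphs

variable (l : ℕ)

/-! ## 1. The case `Ċ̲` -/

section Cases

/-- `z^c = z^{(c)}`: `embCu (c, 1) = embCu (ofAdd 1, 1) ^ val(c)`. (toy bookkeeping; no claim about print) [cite: MochizukiEtTh2009, Rmk 2.6.1 p.40] -/
theorem zc_eq_z_pow [NeZero l] (c : Multiplicative (ZMod l)) : embCu l (c, 1) = embCu l (ofAdd 1, 1) ^ (toAdd c).val := by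
  rw [← map_pow, Prod.pow_mk, one_pow, ← ofAdd_nsmul, nsmul_eq_mul, mul_one, ZMod.natCast_zmod_val, ofAdd_toAdd]

/-- **An automorphism acting on `η⟨z⟩` by `z ↦ z^k` has `k` invertible** (`k · k' = 1` for the exponent `k'` of its inverse).
(toy bookkeeping for [EtTh] Rmk. 2.6.1 «`μ_l ⊆ Aut_K`»; no claim about print) [cite: MochizukiEtTh2009, Rmk 2.6.1 p.40] -/
theorem toAdd_mul_eq_one_of_zc_aut [NeZero l] {W : Subgroup (PiC l)} (hzW : toHat l (embCu l (ofAdd 1, 1)) ∈ W) (δ : ↥W ≃ₜ* ↥W)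
    (k k' : Multiplicative (ZMod l)) (hk : (δ ⟨toHat l (embCu l (ofAdd 1, 1)), hzW⟩ : PiC l) = toHat l (embCu l (k, 1)))
    (hk' : (δ.symm ⟨toHat l (embCu l (ofAdd 1, 1)), hzW⟩ : PiC l) = toHat l (embCu l (k', 1))) : toAdd k' * toAdd k = 1 := by
  have h1 : δ.symm ⟨toHat l (embCu l (ofAdd 1, 1)), hzW⟩ = ⟨toHat l (embCu l (ofAdd 1, 1)), hzW⟩ ^ (toAdd k').val := by
    apply Subtype.ext
    rw [hk', SubgroupClass.coe_pow, ← map_pow, ← zc_eq_z_pow]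
  have h2 := congrArg δ h1
  rw [ContinuousMulEquiv.apply_symm_apply, map_pow] at h2
  have h3 := congrArg Subtype.val h2
  rw [SubgroupClass.coe_pow, hk, ← map_pow, ← map_pow, Prod.pow_mk, one_pow] at h3
  have h4 := congrArg (fun g => cC l g) (toHat_injective l h3)
  simp only [cC_embCu, toAdd_ofAdd, toAdd_pow, nsmul_eq_mul, ZMod.natCast_zmod_val] at h4
  exact h4.symm

/-- **Automorphisms of `B = cl(η Π^tp_{Ċ̲})` map `η t` into `R`**: `γ(η t) ∈ A` (elements of `A · ηι` have order dividing `2l`, `η t` has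
infinite order) and the relation `ι t ι⁻¹ = t⁻¹` kills the `η⟨z⟩`-component (no shears in `ℤ/l × D̂_∞`, `l` odd). (toy bookkeeping;
no claim about print) [cite: MochizukiEtTh2009, Prop 2.6 p.40] -/
theorem rot_of_aut_closure_dotCu [NeZero l] (hl : Odd l) {R : Subgroup (PiC l)}
    (hR : R = ((Subgroup.zpowers (embCu l (1, r 1))).map (toHat l).toMonoidHom).topologicalClosure)
    {A : Subgroup (PiC l)}
    (hA : A = (((heisB0 l ⊓ heisPiX l).comap (PhiT l) ⊓ PiCdotT l).map (toHat l).toMonoidHom).topologicalClosure)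
    {B : Subgroup (PiC l)} (hB : B = (((heisB0 l).comap (PhiT l) ⊓ PiCdotT l).map (toHat l).toMonoidHom).topologicalClosure)
    (htB : toHat l (embCu l (1, r 1)) ∈ B) (hιB : iotaM l ∈ B) (δ : ↥B ≃ₜ* ↥B) :
    (δ ⟨toHat l (embCu l (1, r 1)), htB⟩ : PiC l) ∈ R := by
  -- `δ(η t) ∈ A`
  obtain ⟨c₀, x₀, hx₀, h0⟩ : ∃ c₀, ∃ x₀ ∈ R, (δ ⟨toHat l (embCu l (1, r 1)), htB⟩ : PiC l) = toHat l (embCu l (c₀, 1)) * x₀ := by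
    obtain ⟨a, ha, h | h⟩ := (mem_closure_dotCu_iff l hA hB _).mp (δ ⟨toHat l (embCu l (1, r 1)), htB⟩).2
    · obtain ⟨c, x, hx, rfl⟩ := (mem_closure_dotXu_iff l hR hA a).mp ha
      exact ⟨c, x, hx, h⟩
    · exfalso
      obtain ⟨c, x, hx, rfl⟩ := (mem_closure_dotXu_iff l hR hA a).mp ha
      have h2 : (δ ⟨toHat l (embCu l (1, r 1)), htB⟩) ^ (2 * l) = 1 := by
        apply Subtype.ext
        rw [SubgroupClass.coe_pow, h, pow_mul, zc_mul_rot_mul_iotaM_sq l hR c hx, ← map_pow, zc_pow_card, map_one]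
        rfl
      rw [← map_pow, ← map_one δ, δ.apply_eq_iff_eq] at h2
      have h3 : toHat l (embCu l (1, r 1)) ^ (2 * l) = 1 := by
        have := congrArg Subtype.val h2; rwa [SubgroupClass.coe_pow] at this
      exact toHat_t_ne_one l (eq_one_of_pow_eq_one_of_mem_rot l hR (toHat_t_mem l hR) (mul_ne_zero two_ne_zero (NeZero.ne l)) h3)
  -- `δ(η ι) = a₁ · η ι` with `a₁ ∈ A`
  obtain ⟨a₁, ha₁, h1⟩ : ∃ a₁ ∈ A, (δ ⟨iotaM l, hιB⟩ : PiC l) = a₁ * iotaM l := by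
    obtain ⟨a, ha, h | h⟩ := (mem_closure_dotCu_iff l hA hB _).mp (δ ⟨iotaM l, hιB⟩).2
    · exfalso
      obtain ⟨c, x, hx, rfl⟩ := (mem_closure_dotXu_iff l hR hA a).mp ha
      have h2 : (δ ⟨iotaM l, hιB⟩) ^ 2 = 1 := by
        rw [← map_pow, ← map_one δ, δ.apply_eq_iff_eq]
        exact Subtype.ext (by rw [SubgroupClass.coe_pow, pow_two, iotaM_mul_self]; rfl)
      have h3 : (toHat l (embCu l (c, 1)) * x) ^ 2 = 1 := by
        have := congrArg Subtype.val h2; rwa [SubgroupClass.coe_pow, h] at this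
      obtain ⟨hc, hx1⟩ := eq_one_of_sq_eq_one_A l hl hR c hx h3
      rw [hc, hx1, mul_one, show ((1 : Multiplicative (ZMod l)), (1 : DihedralGroup 0)) = 1 from rfl, map_one, map_one] at h
      have h4 : δ ⟨iotaM l, hιB⟩ = 1 := Subtype.ext h
      rw [← map_one δ, δ.apply_eq_iff_eq] at h4
      exact iotaM_ne_one l (congrArg Subtype.val h4)
    · exact ⟨a, ha, h⟩
  -- the relation `ι t ι⁻¹ = t⁻¹`
  have hrel : (⟨iotaM l, hιB⟩ : ↥B) * ⟨toHat l (embCu l (1, r 1)), htB⟩ * ⟨iotaM l, hιB⟩⁻¹ = ⟨toHat l (embCu l (1, r 1)), htB⟩⁻¹ :=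
    Subtype.ext (iotaM_conj_of_mem_rot l hR (toHat_t_mem l hR))
  have hrel2 := congrArg (fun q => ((δ q : ↥B) : PiC l)) hrel
  simp only [map_mul, map_inv, Subgroup.coe_mul, Subgroup.coe_inv, h0, h1] at hrel2
  -- compute the left-hand side: `a₁ ι (z^{c₀} x₀) ι⁻¹ a₁⁻¹ = z^{c₀} x₀⁻¹`
  have hx₀A : toHat l (embCu l (c₀, 1)) * x₀⁻¹ ∈ A :=
    (mem_closure_dotXu_iff l hR hA _).mpr ⟨c₀, x₀⁻¹, R.inv_mem hx₀, rfl⟩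
  have lhs : a₁ * iotaM l * (toHat l (embCu l (c₀, 1)) * x₀) * (a₁ * iotaM l)⁻¹ = toHat l (embCu l (c₀, 1)) * x₀⁻¹ := by
    rw [show a₁ * iotaM l * (toHat l (embCu l (c₀, 1)) * x₀) * (a₁ * iotaM l)⁻¹ =
        a₁ * ((iotaM l * toHat l (embCu l (c₀, 1)) * (iotaM l)⁻¹) * (iotaM l * x₀ * (iotaM l)⁻¹)) * a₁⁻¹ by group,
      iotaM_conj_of_mem_rot l hR hx₀, ← toHat_zc_comm l c₀ (iotaM l), mul_inv_cancel_right,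
      comm_of_mem_A l hR hA ha₁ hx₀A, mul_inv_cancel_right]
  rw [lhs, mul_inv_rev, ← map_inv, ← map_inv, Prod.inv_mk, inv_one, ← toHat_zc_comm l c₀⁻¹ x₀⁻¹] at hrel2
  -- hence `z^{c₀} = z^{c₀⁻¹}`, so `c₀² = 1`, so `c₀ = 1`
  have h5 : toHat l (embCu l (c₀, 1)) = toHat l (embCu l (c₀⁻¹, 1)) := mul_right_cancel hrel2
  have hc5 : c₀ * c₀ = 1 := by
    have e := congrArg (fun g => cC l g) (toHat_injective l h5)
    simp only [cC_embCu, toAdd_inv] at e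
    apply toAdd.injective
    rw [toAdd_mul, toAdd_one]
    linear_combination e
  have h6 : (toHat l (embCu l (c₀, 1)) * 1) ^ 2 = 1 := by
    rw [mul_one, ← map_pow, ← map_pow, Prod.pow_mk, one_pow, pow_two, hc5, ← Prod.one_eq_mk, map_one, map_one]
  obtain ⟨hc₀, -⟩ := eq_one_of_sq_eq_one_A l hl hR c₀ R.one_mem h6
  rw [h0, hc₀, show ((1 : Multiplicative (ZMod l)), (1 : DihedralGroup 0)) = 1 from rfl, map_one, map_one, one_mul]
  exact hx₀

/-- `Σ` fixes `η(z^c)` when it scales the `a`-cycle only. (toy bookkeeping; no claim about print) [cite: MochizukiEtTh2009, Prop 2.6 p.40] -/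
theorem apply_zc_of_scaling (Sg : PiC l ≃ₜ* PiC l) (u : (ZMod l)ˣ)
    (hSinl : ∀ v, Sg (toHat l ((SemidirectProduct.inl v : TG₀ l), 1)) = toHat l ((SemidirectProduct.inl (act l u 0 v) : TG₀ l), 1))
    (c : Multiplicative (ZMod l)) : Sg (toHat l (embCu l (c, 1))) = toHat l (embCu l (c, 1)) := by
  have e : embCu l (c, 1) = ((SemidirectProduct.inl (ofAdd (0, toAdd c)) : TG₀ l), (1 : Multiplicative (ZMod 2))) := rfl
  rw [e, hSinl]
  congr 3
  apply toAdd.injective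
  refine Prod.ext ?_ ?_
  · simp
  · simp

/-- `w · (T · η ι) · w⁻¹ = T · w² · η ι` for `w, T ∈ R`. (toy bookkeeping; no claim about print) [cite: MochizukiEtTh2009, Prop 2.6 p.40] -/
theorem conj_rot_mul_iotaM [NeZero l] {R : Subgroup (PiC l)}
    (hR : R = ((Subgroup.zpowers (embCu l (1, r 1))).map (toHat l).toMonoidHom).topologicalClosure)
    {w T : PiC l} (hw : w ∈ R) (hT : T ∈ R) : w * (T * iotaM l) * w⁻¹ = T * w ^ 2 * iotaM l := by
  have hTw : w * T = T * w := comm_of_mem_rot l hR hw hT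
  have hιw : iotaM l * w⁻¹ * (iotaM l)⁻¹ = w := by rw [iotaM_conj_of_mem_rot l hR (R.inv_mem hw), inv_inv]
  calc w * (T * iotaM l) * w⁻¹ = (w * T) * (iotaM l * w⁻¹ * (iotaM l)⁻¹) * iotaM l := by group
    _ = (T * w) * w * iotaM l := by rw [hTw, hιw]
    _ = T * w ^ 2 * iotaM l := by rw [pow_two, mul_assoc T w w]

/-- **Case `Ċ̲`** (`Π_{Ċ̲} = B = A ∪ A · η ι ≅ ℤ/l × D̂_∞`): every topological automorphism `γ` of `B` extends to `Π_C` stabilising the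
closures of `Π^tp_{Ċ̲}`, `Π^tp_{C̲}`, `Π^tp_Ċ`. By `rot_of_aut_closure_dotCu`, `γ(η t) ∈ R`; `γ(η z) = η z^k` with `k ∈ (ℤ/l)ˣ`; after the
scaling correction `Σ` (`Σ|_R = γ|_R`) one has `Σ⁻¹γ(η ι) = x · η ι`, `x ∈ R`, `x = η t^ε w²`, so `γ = Σ ∘ conj(w) ∘ (scaleAut k ∘
halfShift(−ε))^∧` on `B`. (the typed [EtTh] Prop. 2.6, profinite clause, case `Ċ̲`, AT THE MODEL; no claim about print)
[cite: MochizukiEtTh2009, Prop 2.6 p.40] -/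
theorem exists_hatExtension_dotCu [NeZero l] (hl : Odd l) {Z : Subgroup (TG l)} (hZ : Z = (heisB0 l).comap (PhiT l))
    {B : Subgroup (PiC l)} (hB : B = ((Z ⊓ PiCdotT l).map (toHat l).toMonoidHom).topologicalClosure) (γ : ↥B ≃ₜ* ↥B) :
    ∃ Γ : PiC l ≃ₜ* PiC l, (∀ h : ↥B, Γ h = γ h) ∧
      B.map Γ.toMulEquiv.toMonoidHom = B ∧
      ((Z.map (toHat l).toMonoidHom).topologicalClosure).map Γ.toMulEquiv.toMonoidHom =
        (Z.map (toHat l).toMonoidHom).topologicalClosure ∧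
      (((PiCdotT l).map (toHat l).toMonoidHom).topologicalClosure).map Γ.toMulEquiv.toMonoidHom =
        ((PiCdotT l).map (toHat l).toMonoidHom).topologicalClosure := by
  subst hZ
  set R := ((Subgroup.zpowers (embCu l (1, r 1))).map (toHat l).toMonoidHom).topologicalClosure with hR
  set A := (((heisB0 l ⊓ heisPiX l).comap (PhiT l) ⊓ PiCdotT l).map (toHat l).toMonoidHom).topologicalClosure with hA
  have hAB : A ≤ B := fun y hy => (mem_closure_dotCu_iff l hA hB y).mpr ⟨y, hy, Or.inl rfl⟩
  have hRA : R ≤ A := fun y hy => by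
    have := (mem_closure_dotXu_iff l hR hA (toHat l (embCu l (1, 1)) * y)).mpr ⟨1, y, hy, rfl⟩
    rwa [show ((1 : Multiplicative (ZMod l)), (1 : DihedralGroup 0)) = 1 from rfl, map_one, map_one, one_mul] at this
  have hRB : R ≤ B := hRA.trans hAB
  have htB : toHat l (embCu l (1, r 1)) ∈ B := hRB (toHat_t_mem l hR)
  have hιB : iotaM l ∈ B := by
    have := (mem_closure_dotCu_iff l hA hB (1 * iotaM l)).mpr ⟨1, A.one_mem, Or.inr rfl⟩
    rwa [one_mul] at this
  have hzcA : ∀ c, toHat l (embCu l (c, 1)) ∈ A := fun c => by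
    have := (mem_closure_dotXu_iff l hR hA _).mpr ⟨c, 1, R.one_mem, rfl⟩
    rwa [mul_one] at this
  have hzB : toHat l (embCu l (ofAdd 1, 1)) ∈ B := hAB (hzcA _)
  -- Step 1: `γ`, `γ⁻¹` map `η t` into `R`; restrict; scaling
  obtain ⟨ρ, hρ, hρ'⟩ := exists_restrict_rot l hR hRB γ (rot_of_aut_closure_dotCu l hl hR hA hB htB hιB γ)
    (rot_of_aut_closure_dotCu l hl hR hA hB htB hιB γ.symm)
  obtain ⟨Sg, hSR, hSR', hSι, -, ⟨u, hSinl⟩, hSstab⟩ := exists_hatScalingEquiv_stabilising l hR ρ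
  have hBc := coordClosed_inf l (coordClosed_heisB0 l) (coordClosed_PiCdotT l)
  have hSB : B.map Sg.toMulEquiv.toMonoidHom = B := by rw [hB]; exact hSstab _ hBc
  -- Step 2: `γ(η z) = η z^k`, `k` a unit
  have hz : ∀ δ : ↥B ≃ₜ* ↥B, ∃ k : Multiplicative (ZMod l), (δ ⟨toHat l (embCu l (ofAdd 1, 1)), hzB⟩ : PiC l) = toHat l (embCu l (k, 1)) := by
    intro δ
    have hl' : (δ ⟨toHat l (embCu l (ofAdd 1, 1)), hzB⟩) ^ l = 1 := by
      rw [← map_pow, ← map_one δ, δ.apply_eq_iff_eq]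
      exact Subtype.ext (by rw [SubgroupClass.coe_pow, ← map_pow, zc_pow_card, map_one]; rfl)
    have hl'' := congrArg Subtype.val hl'
    rw [SubgroupClass.coe_pow] at hl''
    obtain ⟨a, ha, h | h⟩ := (mem_closure_dotCu_iff l hA hB _).mp (δ ⟨toHat l (embCu l (ofAdd 1, 1)), hzB⟩).2
    · obtain ⟨k, x, hx, rfl⟩ := (mem_closure_dotXu_iff l hR hA a).mp ha
      rw [h] at hl''
      refine ⟨k, ?_⟩
      rw [h, exists_eq_zc_of_pow_l_eq_one l hR k hx hl'', mul_one]
    · exfalso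
      obtain ⟨c, x, hx, rfl⟩ := (mem_closure_dotXu_iff l hR hA a).mp ha
      obtain ⟨m, hm⟩ := hl
      have e3 : (toHat l (embCu l (c, 1)) * x * iotaM l) ^ l =
          ((toHat l (embCu l (c, 1)) * x * iotaM l) ^ 2) ^ m * (toHat l (embCu l (c, 1)) * x * iotaM l) := by
        rw [← pow_mul, ← pow_succ, ← hm]
      rw [h, e3, zc_mul_rot_mul_iotaM_sq l hR c hx, ← map_pow, ← map_pow, Prod.pow_mk, one_pow, ← mul_assoc,
        ← mul_assoc, ← map_mul, ← map_mul, Prod.mk_mul_mk, one_mul, OneMemClass.coe_one] at hl''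
      refine zc_mul_rot_ne_mul_iotaM l hR 1 ((c ^ 2) ^ m * c) R.one_mem hx ?_
      rw [mul_one, show ((1 : Multiplicative (ZMod l)), (1 : DihedralGroup 0)) = 1 from rfl, map_one, map_one]
      exact hl''.symm
  obtain ⟨k, hk⟩ := hz γ
  obtain ⟨k', hk'⟩ := hz γ.symm
  have hkk' : toAdd k' * toAdd k = 1 := toAdd_mul_eq_one_of_zc_aut l hzB γ k k' hk hk'
  let uk : (ZMod l)ˣ := Units.mkOfMulEqOne (toAdd k) (toAdd k') (by rw [mul_comm]; exact hkk')
  have huk : ((uk : (ZMod l)ˣ) : ZMod l) = toAdd k := rfl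
  -- Step 3: `y := Σ⁻¹ γ(η ι) = x · η ι`, `x ∈ R`
  set y := Sg.symm (γ ⟨iotaM l, hιB⟩ : PiC l) with hy
  have hyB : y ∈ B := by
    have : (γ ⟨iotaM l, hιB⟩ : PiC l) ∈ B.map Sg.toMulEquiv.toMonoidHom := by rw [hSB]; exact (γ _).2
    obtain ⟨d, hd, hd'⟩ := this
    rw [hy, ← hd']
    change Sg.symm (Sg d) ∈ B
    rwa [Sg.symm_apply_apply]
  have hι2 : (⟨iotaM l, hιB⟩ : ↥B) ^ 2 = 1 := Subtype.ext (by rw [SubgroupClass.coe_pow, pow_two, iotaM_mul_self]; rfl)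
  have hy2 : y ^ 2 = 1 := by
    rw [hy, ← map_pow, ← SubgroupClass.coe_pow, ← map_pow, hι2, map_one, OneMemClass.coe_one, map_one]
  obtain ⟨x, hx, hxy⟩ : ∃ x ∈ R, y = x * iotaM l := by
    obtain ⟨a, ha, h | h⟩ := (mem_closure_dotCu_iff l hA hB y).mp hyB
    · exfalso
      obtain ⟨c, x, hx, rfl⟩ := (mem_closure_dotXu_iff l hR hA a).mp ha
      obtain ⟨hc, hx1⟩ := eq_one_of_sq_eq_one_A l hl hR c hx (h ▸ hy2)
      have hy1 : y = 1 := by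
        rw [h, hc, hx1, show ((1 : Multiplicative (ZMod l)), (1 : DihedralGroup 0)) = 1 from rfl, map_one, map_one, one_mul]
      have : (γ ⟨iotaM l, hιB⟩ : PiC l) = 1 := by
        rw [show (γ ⟨iotaM l, hιB⟩ : PiC l) = Sg y by rw [hy, Sg.apply_symm_apply], hy1, map_one]
      have h4 : γ ⟨iotaM l, hιB⟩ = 1 := Subtype.ext this
      rw [← map_one γ, γ.apply_eq_iff_eq] at h4
      exact iotaM_ne_one l (congrArg Subtype.val h4)
    · obtain ⟨c, x, hx, rfl⟩ := (mem_closure_dotXu_iff l hR hA a).mp ha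
      have h2 := hy2
      rw [h, zc_mul_rot_mul_iotaM_sq l hR c hx] at h2
      have h3 : (toHat l (embCu l (c, 1)) * 1) ^ 2 = 1 := by
        rw [mul_one, ← map_pow, ← map_pow, Prod.pow_mk, one_pow]; exact h2
      obtain ⟨hc, -⟩ := eq_one_of_sq_eq_one_A l hl hR c R.one_mem h3
      refine ⟨x, hx, ?_⟩
      rw [h, hc, show ((1 : Multiplicative (ZMod l)), (1 : DihedralGroup 0)) = 1 from rfl, map_one, map_one, one_mul]
  -- Step 4: `x = η t^ε · w²`
  obtain ⟨w, hw, hxw⟩ := exists_sq_or_t_mul_sq_of_mem_rot l hR hx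
  obtain ⟨ε, hε⟩ : ∃ ε : ℤ, x = toHat l (embCu l (1, r 1)) ^ ε * w ^ 2 := by
    rcases hxw with h | h
    · exact ⟨0, by rw [zpow_zero, one_mul]; exact h⟩
    · exact ⟨1, by rw [zpow_one]; exact h⟩
  -- Step 5: the tempered part and the conjugation
  let Γ₀ : TG l ≃* TG l := (scaleAut l uk).trans (halfShift l hl (-(show ZMod 0 from ε)))
  have hΓ₀cd : ∀ (c : Multiplicative (ZMod l)) (d : DihedralGroup 0),
      Γ₀ (embCu l (c, d)) = embCu l (ofAdd (toAdd k * toAdd c), dihedralShift (-(show ZMod 0 from ε)) d) := fun c d => by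
    change halfShift l hl _ (scaleAut l uk (embCu l (c, d))) = _
    rw [scaleAut_embCu, halfShift_embCu, huk]
  have hΓ₀t : ∀ j : ℤ, Γ₀ (embCu l (1, r 1) ^ j) = embCu l (1, r 1) ^ j := fun j => by
    rw [map_zpow, hΓ₀cd, dihedralShift_r, toAdd_one, mul_zero, ofAdd_zero]
  have hΓ₀z : ∀ c : Multiplicative (ZMod l), Γ₀ (embCu l (c, 1)) = embCu l (ofAdd (toAdd k * toAdd c), 1) := fun c => by
    rw [hΓ₀cd, one_def, dihedralShift_r]
  have hΓ₀ι : Γ₀ (iotaT l) = embCu l (1, r 1) ^ ε * iotaT l := by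
    change Γ₀ (embCu l (1, sr 0)) = _
    rw [hΓ₀cd, dihedralShift_sr, zero_add, toAdd_one, mul_zero, ofAdd_zero, (embCu_one_dihedral l _).2, iotaT_mul_t_zpow,
      ← zpow_neg]
    congr 2
    change -(-ε) = ε
    rw [neg_neg]
  obtain ⟨Γh, hΓh⟩ := exists_completion_of_mulEquiv l Γ₀
  obtain ⟨Cw, hCw⟩ := exists_conj_continuousMulEquiv l w
  have hwR : ∀ q ∈ R, Cw q = q := fun q hq => by rw [hCw, comm_of_mem_rot l hR hw hq, mul_inv_cancel_right]
  have hwzc : ∀ c, Cw (toHat l (embCu l (c, 1))) = toHat l (embCu l (c, 1)) := fun c => by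
    rw [hCw, ← toHat_zc_comm l c w, mul_inv_cancel_right]
  -- values of `Γ := Σ ∘ C_w ∘ Γ̂₀` on `η t^j`, `η z^c`, `η ι`
  have ht : ∀ j : ℤ, (Γh.trans (Cw.trans Sg)) (toHat l (embCu l (1, r 1) ^ j)) =
      γ ⟨toHat l (embCu l (1, r 1) ^ j), hRB (toHat_t_zpow_mem l hR j)⟩ := fun j => by
    rw [ContinuousMulEquiv.trans_apply, ContinuousMulEquiv.trans_apply, hΓh, hΓ₀t, hwR _ (toHat_t_zpow_mem l hR j)]
    exact (hSR ⟨_, toHat_t_zpow_mem l hR j⟩).trans (hρ ⟨_, toHat_t_zpow_mem l hR j⟩)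
  have hzc : ∀ c : Multiplicative (ZMod l), (Γh.trans (Cw.trans Sg)) (toHat l (embCu l (c, 1))) =
      γ ⟨toHat l (embCu l (c, 1)), hAB (hzcA c)⟩ := fun c => by
    rw [ContinuousMulEquiv.trans_apply, ContinuousMulEquiv.trans_apply, hΓh, hΓ₀z, hwzc, apply_zc_of_scaling l Sg u hSinl]
    -- `γ(η z^c) = γ(η z)^{val c} = η z^{k c}`
    have e1 : (⟨toHat l (embCu l (c, 1)), hAB (hzcA c)⟩ : ↥B) = ⟨toHat l (embCu l (ofAdd 1, 1)), hzB⟩ ^ (toAdd c).val := by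
      apply Subtype.ext; rw [SubgroupClass.coe_pow, ← map_pow, ← zc_eq_z_pow]
    rw [e1, map_pow, SubgroupClass.coe_pow, hk, ← map_pow, ← map_pow, Prod.pow_mk, one_pow]
    congr 3
    apply toAdd.injective
    rw [toAdd_ofAdd, toAdd_pow, nsmul_eq_mul, ZMod.natCast_zmod_val, mul_comm]
  have hι : (Γh.trans (Cw.trans Sg)) (iotaM l) = γ ⟨iotaM l, hιB⟩ := by
    rw [ContinuousMulEquiv.trans_apply, ContinuousMulEquiv.trans_apply]
    conv_lhs => rw [show iotaM l = toHat l (iotaT l) from rfl]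
    rw [hΓh, hΓ₀ι, map_mul, map_zpow, show toHat l (iotaT l) = iotaM l from rfl, hCw,
      conj_rot_mul_iotaM l hR hw (R.zpow_mem (toHat_t_mem l hR) ε), ← hε, ← hxy, hy, Sg.apply_symm_apply]
  refine ⟨Γh.trans (Cw.trans Sg), ?_, ?_, ?_, ?_⟩
  · intro h
    subst hB
    have key := eq_of_eqOn_subgroup_of_continuous (((heisB0 l).comap (PhiT l) ⊓ PiCdotT l).map (toHat l).toMonoidHom)
      (f := fun h => (Γh.trans (Cw.trans Sg)) (h : PiC l)) (g := fun h => (γ h : PiC l))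
      ((map_continuous _).comp continuous_subtype_val) (continuous_subtype_val.comp γ.continuous) ?_
    · exact congrFun key h
    · intro q hq
      have hqB : q ∈ ((((heisB0 l).comap (PhiT l)) ⊓ PiCdotT l).map (toHat l).toMonoidHom).topologicalClosure :=
        Subgroup.le_topologicalClosure _ hq
      obtain ⟨g, hg, rfl⟩ := hq
      rw [← range_embCu] at hg
      obtain ⟨⟨c, d⟩, rfl⟩ := hg
      change (Γh.trans (Cw.trans Sg)) (toHat l (embCu l (c, d))) = γ ⟨toHat l (embCu l (c, d)), hqB⟩
      rcases d with i | i
      · have e := embCu_eq_mul l c (r i)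
        have e' := (embCu_one_dihedral l i).1
        have hm : (⟨toHat l (embCu l (c, r i)), hqB⟩ :
            ↥((((heisB0 l).comap (PhiT l)) ⊓ PiCdotT l).map (toHat l).toMonoidHom).topologicalClosure) =
            ⟨toHat l (embCu l (c, 1)), hAB (hzcA c)⟩ * ⟨toHat l (embCu l (1, r 1) ^ (show ℤ from i)), hRB (toHat_t_zpow_mem l hR _)⟩ :=
          Subtype.ext (by
            change toHat l (embCu l (c, r i)) = toHat l (embCu l (c, 1)) * toHat l (embCu l (1, r 1) ^ (show ℤ from i))
            rw [e, e', map_mul])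
        rw [hm, map_mul, Subgroup.coe_mul, ← hzc, ← ht, ← map_mul, e, e', map_mul]
      · have e := embCu_eq_mul l c (sr i)
        have e' := (embCu_one_dihedral l i).2
        have hm : (⟨toHat l (embCu l (c, sr i)), hqB⟩ :
            ↥((((heisB0 l).comap (PhiT l)) ⊓ PiCdotT l).map (toHat l).toMonoidHom).topologicalClosure) =
            ⟨toHat l (embCu l (c, 1)), hAB (hzcA c)⟩ * (⟨iotaM l, hιB⟩ *
              ⟨toHat l (embCu l (1, r 1) ^ (show ℤ from i)), hRB (toHat_t_zpow_mem l hR _)⟩) :=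
          Subtype.ext (by
            change toHat l (embCu l (c, sr i)) = toHat l (embCu l (c, 1)) * (iotaM l * toHat l (embCu l (1, r 1) ^ (show ℤ from i)))
            rw [e, e', map_mul, map_mul]; rfl)
        have lhs : (Γh.trans (Cw.trans Sg)) (toHat l (embCu l (c, sr i))) =
            (Γh.trans (Cw.trans Sg)) (toHat l (embCu l (c, 1))) * ((Γh.trans (Cw.trans Sg)) (iotaM l) *
              (Γh.trans (Cw.trans Sg)) (toHat l (embCu l (1, r 1) ^ (show ℤ from i)))) := by
          rw [← map_mul, ← map_mul, iotaM, ← map_mul, ← map_mul, ← e', ← e]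
        rw [lhs, hm, map_mul, map_mul, Subgroup.coe_mul, Subgroup.coe_mul, hzc, ht, hι]
  · rw [hB] at hSB hRB ⊢
    exact map_ctrans_eq l _ _ _ (map_closure_eq_of_completion l Γh Γ₀ hΓh _ (by
      rw [Subgroup.map_inf_eq _ _ Γ₀.toMonoidHom Γ₀.injective]
      exact congrArg₂ (· ⊓ ·) (map_trans_eq _ _ _ (scaleAut_stabilises l uk).1 (halfShift_stabilises l hl _).1)
        (map_trans_eq _ _ _ (scaleAut_stabilises l uk).2.2.2 (halfShift_stabilises l hl _).2.2.2)))
      (map_ctrans_eq l _ _ _ (map_eq_of_conj_mem l Cw w hCw _ (hRB hw)) hSB)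
  · exact map_ctrans_eq l _ _ _ (map_closure_eq_of_completion l Γh Γ₀ hΓh _
      (map_trans_eq _ _ _ (scaleAut_stabilises l uk).1 (halfShift_stabilises l hl _).1))
      (map_ctrans_eq l _ _ _ (map_eq_of_conj_mem l Cw w hCw _ (by
        refine (show R ≤ _ from ?_) hw
        rw [hR]
        exact Subgroup.topologicalClosure_mono (Subgroup.map_mono ((Subgroup.zpowers_le).mpr (coordClosed_heisB0 l).1))))
        (hSstab _ (coordClosed_heisB0 l)))
  · exact map_ctrans_eq l _ _ _ (map_closure_eq_of_completion l Γh Γ₀ hΓh _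
      (map_trans_eq _ _ _ (scaleAut_stabilises l uk).2.2.2 (halfShift_stabilises l hl _).2.2.2))
      (map_ctrans_eq l _ _ _ (map_eq_of_conj_mem l Cw w hCw _ (by
        refine (show R ≤ _ from ?_) hw
        rw [hR]
        exact Subgroup.topologicalClosure_mono (Subgroup.map_mono ((Subgroup.zpowers_le).mpr (coordClosed_PiCdotT l).1))))
        (hSstab _ (coordClosed_PiCdotT l)))

end Cases

end Literature.AnabelianGeometry.EtaleTheta.ThetaCovers.MonodromyModel

end
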